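import Summits.CriticalPhenomena.PercolationContinuityZ3.Theorems.PercNearOneGluingNoHeavyLowerTailApexTwoSum
import HarnessLib

/-!
# `NoHeavyLowerTail` (stmt-CriticalPhenomena-4575) — 2-sums through the apex, part 6:
# symmetry of R1, the adjacent base case, and the PENDANT (1-sum) theorem

Support file (prover prim-gen-kcluster gen 72; `--supports stmt-CriticalPhenomena-4575`).  No definitions, no named
facts, no sorries.  Vocabulary as in part 5 (`…ApexTwoSum`): instance `(a; s, t)` of R1 with support `D` for the free
random-cluster measure `φ = rcMeasureW u q ∅`: `φ(T)·φ(S_D) ≤ φ(U_s)·φ(U_t)`.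

* `ApexTwoSum.r1_symm` — R1 for `(a; s, t)` gives R1 for `(a; t, s)` (the cells are symmetric, `RefinedRowR3.sep_comm`).
* `ApexTwoSum.r1_of_adjacent` — if the terminals are adjacent in the support (`s(s,t) ∈ D`) then the separating cell is
  empty and R1 holds trivially.
* `ApexTwoSum.r1_of_pendant` — THE PENDANT (1-SUM) THEOREM (every `q > 0`): in the setting of the 2-sum theorem (arms `DX ∋ b`,
  `DY ∋ c` meeting only in `{a, h}`), if the apex `a` touches NO pair of `DX` and `b` is joined to the hub `h` in the support `DX`
  (so `X` is a block hanging at the cut vertex `h`, e.g. a pendant edge `bh`), then R1 for `(a; c, h)` on the arm `Y` ALONE implies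
  R1 for `(a; b, c)` on the glued graph — no FKG slack and no non-degeneracy needed.  This is the degenerate stratum
  `A_X = B_X = C_X = N_X = 0` of the dictionary of parts 1–4, where `U_b U_c − T S = q D_X (D_X + E_X) ρ_Y`
  with `ρ_Y = B_Y C_Y − A_Y N_Y` the R1 slack of `Y` (KCL{η : BondConfig V | s ∈ cl η.toFinset a ∧ t ∉ cl η.toFinset a}ER-gen69 §5.2 / THEOREM-3SUM Lemma 5.2 at the measure level,
  validated numerically in HOME/code/gen72/pendant_check.py).
-/

noncomputable section

namespace Summit.CriticalPhenomena.PercolationContinuityZ3.Theorems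

namespace ApexTwoSum

open Finset SimpleGraph Literature.Probability.Percolation Literature.Probability.Percolation.Gladkov
open Literature.Probability.Percolation.BHK2006 (weight)
open Literature.Probability.Percolation.DecisionTree (ind ind_of_mem ind_of_not_mem ind_nonneg)
open Literature.Probability.LatticeModels RefinedRowR3 ThreePointLB MeasureTheory
open scoped Classical

variable {V : Type*} [Fintype V]

/-! ### Symmetry and the adjacent base case -/

section Basic

variable {a s t : V} (u : Sym2 V → unitInterval) (q : ℝ) (D : Finset (Sym2 V))

/-- **R1 is symmetric in the two terminals.** [this work] -/
theorem r1_symm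
    (h : (rcMeasureW u q ∅).real {η : BondConfig V | s ∈ cl η.toFinset a ∧ t ∈ cl η.toFinset a} * (rcMeasureW u q ∅).real {η : BondConfig V | s ∉ cl η.toFinset a ∧ t ∉ cl η.toFinset a ∧ Sep D (cl η.toFinset a) s t} ≤
      (rcMeasureW u q ∅).real {η : BondConfig V | s ∈ cl η.toFinset a ∧ t ∉ cl η.toFinset a} * (rcMeasureW u q ∅).real {η : BondConfig V | s ∉ cl η.toFinset a ∧ t ∈ cl η.toFinset a}) :
    (rcMeasureW u q ∅).real {η : BondConfig V | t ∈ cl η.toFinset a ∧ s ∈ cl η.toFinset a} * (rcMeasureW u q ∅).real {η : BondConfig V | t ∉ cl η.toFinset a ∧ s ∉ cl η.toFinset a ∧ Sep D (cl η.toFinset a) t s} ≤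
      (rcMeasureW u q ∅).real {η : BondConfig V | t ∈ cl η.toFinset a ∧ s ∉ cl η.toFinset a} * (rcMeasureW u q ∅).real {η : BondConfig V | t ∉ cl η.toFinset a ∧ s ∈ cl η.toFinset a} := by
  have e1 : {η : BondConfig V | t ∈ cl η.toFinset a ∧ s ∈ cl η.toFinset a} = {η : BondConfig V | s ∈ cl η.toFinset a ∧ t ∈ cl η.toFinset a} := by
    ext η; simp only [Set.mem_setOf_eq]; exact and_comm
  have e2 : {η : BondConfig V | t ∉ cl η.toFinset a ∧ s ∉ cl η.toFinset a ∧ Sep D (cl η.toFinset a) t s} = {η : BondConfig V | s ∉ cl η.toFinset a ∧ t ∉ cl η.toFinset a ∧ Sep D (cl η.toFinset a) s t} := by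
    ext η; simp only [Set.mem_setOf_eq]
    exact ⟨fun hη => ⟨hη.2.1, hη.1, sep_comm.1 hη.2.2⟩, fun hη => ⟨hη.2.1, hη.1, sep_comm.1 hη.2.2⟩⟩
  have e3 : {η : BondConfig V | t ∈ cl η.toFinset a ∧ s ∉ cl η.toFinset a} = {η : BondConfig V | s ∉ cl η.toFinset a ∧ t ∈ cl η.toFinset a} := by
    ext η; simp only [Set.mem_setOf_eq]; exact and_comm
  have e4 : {η : BondConfig V | t ∉ cl η.toFinset a ∧ s ∈ cl η.toFinset a} = {η : BondConfig V | s ∈ cl η.toFinset a ∧ t ∉ cl η.toFinset a} := by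
    ext η; simp only [Set.mem_setOf_eq]; exact and_comm
  rw [e1, e2, e3, e4, mul_comm ((rcMeasureW u q ∅).real {η : BondConfig V | s ∉ cl η.toFinset a ∧ t ∈ cl η.toFinset a})]
  exact h

/-- **Adjacent terminals: R1 is trivial.**  If `s(s,t) ∈ D` (and `s ≠ t`), no cluster avoiding `s, t` meets every `s–t` path of `D`,
so the separating cell is empty. [this work] -/
theorem r1_of_adjacent (hst : s ≠ t) (hD : s(s, t) ∈ D) :
    (rcMeasureW u q ∅).real {η : BondConfig V | s ∈ cl η.toFinset a ∧ t ∈ cl η.toFinset a} * (rcMeasureW u q ∅).real {η : BondConfig V | s ∉ cl η.toFinset a ∧ t ∉ cl η.toFinset a ∧ Sep D (cl η.toFinset a) s t} ≤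
      (rcMeasureW u q ∅).real {η : BondConfig V | s ∈ cl η.toFinset a ∧ t ∉ cl η.toFinset a} * (rcMeasureW u q ∅).real {η : BondConfig V | s ∉ cl η.toFinset a ∧ t ∈ cl η.toFinset a} := by
  have hS : {η : BondConfig V | s ∉ cl η.toFinset a ∧ t ∉ cl η.toFinset a ∧ Sep D (cl η.toFinset a) s t} = (∅ : Set (BondConfig V)) := by
    ext η
    simp only [Set.mem_setOf_eq, Set.mem_empty_iff_false, iff_false, not_and]
    intro hs ht hsep
    unfold RefinedRowR3.Sep at hsep
    refine hsep (mem_cl_of_adj (mem_cl_self _ _) ?_)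
    rw [adj_iff, Finset.mem_sdiff, mk_mem_touch, not_or]
    exact ⟨⟨hD, hs, ht⟩, hst⟩
  rw [hS, measureReal_empty, mul_zero]
  exact mul_nonneg measureReal_nonneg measureReal_nonneg

end Basic

/-! ### Arm cells of a block not touching the apex -/

section Isolated

variable {DX : Finset (Sym2 V)} {a h b : V} (wX : Sym2 V → unitInterval) (q : ℝ)
  (hX' : ∀ e ∉ (↑DX : Set (Sym2 V)), wX e = 0)
include hX'

/-- In a block not touching the apex, an arm cell requiring `b ∈ C(a)` or `h ∈ C(a)` has wired mass zero. [this work] -/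
theorem arm_mass_eq_zero_of_isolated (hah : a ≠ h) (hab : a ≠ b) (haX : ∀ e ∈ DX, a ∉ e) {E : Set (BondConfig V)}
    (hE : ∀ η ∈ E, b ∈ cl η.toFinset a ∨ h ∈ cl η.toFinset a) :
    ∑ η : BondConfig V, rcWeightW wX q ({a, h} : Set V) η * ind E η = 0 := by
  have hwX : ∀ e, e ∉ (↑DX : Set (Sym2 V)) → (wX e : ℝ) = 0 := fun e he => by rw [hX' e he]; rfl
  refine Finset.sum_eq_zero fun η _ => ?_
  by_cases hη : η ⊆ (↑DX : Set (Sym2 V))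
  · have hiso : ∀ e ∈ η.toFinset, a ∉ e := fun e he => by
      rw [Set.mem_toFinset] at he; exact haX e (hη he)
    have hE0 : η ∉ E := fun hηE => by
      rcases hE η hηE with hb | hh
      · exact hab (eq_of_mem_cl_of_forall_not_mem hiso hb).symm
      · exact hah (eq_of_mem_cl_of_forall_not_mem hiso hh).symm
    rw [ind_of_not_mem hE0, mul_zero]
  · obtain ⟨e, heη, heD⟩ := Set.not_subset.1 hη
    unfold rcWeightW
    rw [weight_eq_zero_of_mem_not_mem wX hwX heη heD]; ring

/-- In a block not touching the apex in which `b` is joined to the hub by support pairs, the separating arm cell has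
wired mass zero. [this work] -/
theorem arm_N_eq_zero_of_isolated (haX : ∀ e ∈ DX, a ∉ e) (hbh : h ∈ cl DX b) :
    ∑ η : BondConfig V, rcWeightW wX q ({a, h} : Set V) η * ind {η : BondConfig V | b ∉ cl η.toFinset a ∧ h ∉ cl η.toFinset a ∧ Sep DX (cl η.toFinset a) b h} η = 0 := by
  have hwX : ∀ e, e ∉ (↑DX : Set (Sym2 V)) → (wX e : ℝ) = 0 := fun e he => by rw [hX' e he]; rfl
  refine Finset.sum_eq_zero fun η _ => ?_
  by_cases hη : η ⊆ (↑DX : Set (Sym2 V))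
  · have hiso : ∀ e ∈ η.toFinset, a ∉ e := fun e he => by
      rw [Set.mem_toFinset] at he; exact haX e (hη he)
    have hE0 : η ∉ {η : BondConfig V | b ∉ cl η.toFinset a ∧ h ∉ cl η.toFinset a ∧ Sep DX (cl η.toFinset a) b h} := fun hηE => by
      have hsep := hηE.2.2
      unfold RefinedRowR3.Sep at hsep
      have hDD : DX \ touch (cl η.toFinset a) = DX := by
        refine Finset.sdiff_eq_self_of_disjoint (Finset.disjoint_left.2 fun e he hte => ?_)
        obtain ⟨x, hx, hxe⟩ := mem_touch.1 hte
        have hxa : x = a := eq_of_mem_cl_of_forall_not_mem hiso hx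
        exact haX e he (hxa ▸ hxe)
      rw [hDD] at hsep
      exact hsep hbh
    rw [ind_of_not_mem hE0, mul_zero]
  · obtain ⟨e, heη, heD⟩ := Set.not_subset.1 hη
    unfold rcWeightW
    rw [weight_eq_zero_of_mem_not_mem wX hwX heη heD]; ring

end Isolated

/-! ### The pendant (1-sum) theorem -/

section Pendant

variable {DX DY D : Finset (Sym2 V)} {a h b c : V} (hah : a ≠ h) (hab : a ≠ b) (hac : a ≠ c) (hbc : b ≠ c)
  (hhb : h ≠ b) (hhc : h ≠ c)
  (hsepD : ∀ v : V, (∃ e ∈ DX, v ∈ e) → (∃ e ∈ DY, v ∈ e) → (v = a ∨ v = h))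
  (hbY : ∀ e ∈ DY, b ∉ e) (hcX : ∀ e ∈ DX, c ∉ e) (hD : ∀ e, e ∈ D ↔ e ∈ DX ∨ e ∈ DY)
  (w wX wY : Sym2 V → unitInterval) {q : ℝ} (hq : 0 < q)
  (hw : ∀ e, e ∉ (↑DX ∪ ↑DY : Set (Sym2 V)) → (w e : ℝ) = 0)
  (hX : ∀ e ∈ (↑DX : Set (Sym2 V)), wX e = w e) (hX' : ∀ e ∉ (↑DX : Set (Sym2 V)), wX e = 0)
  (hY : ∀ e ∈ (↑DX : Set (Sym2 V)), wY e = 0) (hY' : ∀ e ∉ (↑DX : Set (Sym2 V)), wY e = w e)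
include hah hab hac hbc hhb hhc hsepD hbY hcX hD hq hw hX hX' hY hY'

/-- **The pendant (1-sum) theorem for R1, measure level** (every `q > 0`): in the setting of `r1_of_apexTwoSum`, if the
apex touches no pair of the arm `X` and `b` is joined to the hub in the support `DX`, then R1 for `(a; c, h)` on the arm `Y`
implies R1 for `(a; b, c)` on the glued graph. [this work] -/
theorem r1_of_pendant (haX : ∀ e ∈ DX, a ∉ e) (hbh : h ∈ cl DX b)
    (hR1Y : (rcMeasureW wY q ∅).real {η : BondConfig V | c ∈ cl η.toFinset a ∧ h ∈ cl η.toFinset a} * (rcMeasureW wY q ∅).real {η : BondConfig V | c ∉ cl η.toFinset a ∧ h ∉ cl η.toFinset a ∧ Sep DY (cl η.toFinset a) c h} ≤ (rcMeasureW wY q ∅).real {η : BondConfig V | c ∈ cl η.toFinset a ∧ h ∉ cl η.toFinset a} * (rcMeasureW wY q ∅).real {η : BondConfig V | c ∉ cl η.toFinset a ∧ h ∈ cl η.toFinset a}) :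
    (rcMeasureW w q ∅).real {η : BondConfig V | b ∈ cl η.toFinset a ∧ c ∈ cl η.toFinset a} * (rcMeasureW w q ∅).real {η : BondConfig V | b ∉ cl η.toFinset a ∧ c ∉ cl η.toFinset a ∧ Sep D (cl η.toFinset a) b c} ≤ (rcMeasureW w q ∅).real {η : BondConfig V | b ∈ cl η.toFinset a ∧ c ∉ cl η.toFinset a} * (rcMeasureW w q ∅).real {η : BondConfig V | b ∉ cl η.toFinset a ∧ c ∈ cl η.toFinset a} := by
  have hDD : D = DX ∪ DY := by ext e; rw [Finset.mem_union]; exact hD e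
  subst hDD
  -- the vanishing arm cells of `X`
  have zA := arm_mass_eq_zero_of_isolated wX q hX' hah hab haX (E := {η : BondConfig V | b ∈ cl η.toFinset a ∧ h ∈ cl η.toFinset a}) (fun η hη => Or.inl hη.1)
  have zB := arm_mass_eq_zero_of_isolated wX q hX' hah hab haX (E := {η : BondConfig V | b ∉ cl η.toFinset a ∧ h ∈ cl η.toFinset a}) (fun η hη => Or.inr hη.2)
  have zC := arm_mass_eq_zero_of_isolated wX q hX' hah hab haX (E := {η : BondConfig V | b ∈ cl η.toFinset a ∧ h ∉ cl η.toFinset a}) (fun η hη => Or.inl hη.1)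
  have zN := arm_N_eq_zero_of_isolated wX q hX' haX hbh
  -- positivity
  have hZ := rcPartitionFunctionW_pos w hq (∅ : Set V)
  have hZY := rcPartitionFunctionW_pos wY hq (∅ : Set V)
  have hK : 0 < q ^ clusterCount (∅ : BondConfig V) ({a, h} : Set V) := pow_pos hq _
  have hnn : ∀ (u : Sym2 V → unitInterval) (E : Set (BondConfig V)),
      0 ≤ ∑ η : BondConfig V, rcWeightW u q ({a, h} : Set V) η * ind E η := fun u E =>
    Finset.sum_nonneg fun η _ => mul_nonneg (rcWeightW_nonneg u hq.le _ η) (ind_nonneg E η)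
  -- measures as sums
  simp only [rcMeasureW_real_eq_sum_div w hq, rcMeasureW_real_eq_sum_div wY hq] at hR1Y ⊢
  rw [free_eq_wired hah wY q (E := {η : BondConfig V | c ∈ cl η.toFinset a ∧ h ∈ cl η.toFinset a}) (fun η hη => hη.2), free_eq_q_wired hah wY q (E := {η : BondConfig V | c ∉ cl η.toFinset a ∧ h ∉ cl η.toFinset a ∧ Sep DY (cl η.toFinset a) c h}) (fun η hη => hη.2.1),
    free_eq_q_wired hah wY q (E := {η : BondConfig V | c ∈ cl η.toFinset a ∧ h ∉ cl η.toFinset a}) (fun η hη => hη.2), free_eq_wired hah wY q (E := {η : BondConfig V | c ∉ cl η.toFinset a ∧ h ∈ cl η.toFinset a}) (fun η hη => hη.2)] at hR1Y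
  -- clear denominators in the goal and use the dictionary
  rw [div_mul_div_comm, div_mul_div_comm]
  refine div_le_div_of_nonneg_right ?_ (mul_pos hZ hZ).le
  refine le_of_mul_le_mul_right (a := q ^ clusterCount (∅ : BondConfig V) ({a, h} : Set V) * q ^ clusterCount (∅ : BondConfig V) ({a, h} : Set V)) ?_ (mul_pos hK hK)
  have eT := glued_T_sum hah hab hac hsepD hbY hcX w wX wY q hw hX hX' hY hY'
  have eS := glued_S_sum hah hab hac hbc hhb hhc hsepD hbY hcX w wX wY q hw hX hX' hY hY'
  have eUb := glued_Ub_sum hah hab hac hsepD hbY hcX w wX wY q hw hX hX' hY hY'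
  have eUc := glued_Uc_sum hah hab hac hsepD hbY hcX w wX wY q hw hX hX' hY hY'
  rw [show ∀ x y K : ℝ, x * y * (K * K) = (x * K) * (y * K) from fun x y K => by ring, eT, eS,
    show ∀ x y K : ℝ, x * y * (K * K) = (x * K) * (y * K) from fun x y K => by ring, eUb, eUc,
    zA, zB, zC, zN]
  -- name the remaining wired masses
  set XD := (∑ η : BondConfig V, rcWeightW wX q ({a, h} : Set V) η * ind {η : BondConfig V | b ∉ cl η.toFinset a ∧ h ∉ cl η.toFinset a ∧ h ∈ cl η.toFinset b} η) with hXD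
  set XE := (∑ η : BondConfig V, rcWeightW wX q ({a, h} : Set V) η * ind {η : BondConfig V | b ∉ cl η.toFinset a ∧ h ∉ cl η.toFinset a ∧ h ∉ cl η.toFinset b} η) with hXE
  set YA := (∑ η : BondConfig V, rcWeightW wY q ({a, h} : Set V) η * ind {η : BondConfig V | c ∈ cl η.toFinset a ∧ h ∈ cl η.toFinset a} η) with hYA
  set YB := (∑ η : BondConfig V, rcWeightW wY q ({a, h} : Set V) η * ind {η : BondConfig V | c ∉ cl η.toFinset a ∧ h ∈ cl η.toFinset a} η) with hYB
  set YC := (∑ η : BondConfig V, rcWeightW wY q ({a, h} : Set V) η * ind {η : BondConfig V | c ∈ cl η.toFinset a ∧ h ∉ cl η.toFinset a} η) with hYC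
  set YD := (∑ η : BondConfig V, rcWeightW wY q ({a, h} : Set V) η * ind {η : BondConfig V | c ∉ cl η.toFinset a ∧ h ∉ cl η.toFinset a ∧ h ∈ cl η.toFinset c} η) with hYD
  set YE := (∑ η : BondConfig V, rcWeightW wY q ({a, h} : Set V) η * ind {η : BondConfig V | c ∉ cl η.toFinset a ∧ h ∉ cl η.toFinset a ∧ h ∉ cl η.toFinset c} η) with hYE
  set YN := (∑ η : BondConfig V, rcWeightW wY q ({a, h} : Set V) η * ind {η : BondConfig V | c ∉ cl η.toFinset a ∧ h ∉ cl η.toFinset a ∧ Sep DY (cl η.toFinset a) c h} η) with hYN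
  have hZY2 : 0 < rcPartitionFunctionW wY q ∅ * rcPartitionFunctionW wY q ∅ := mul_pos hZY hZY
  have ρY : 0 ≤ YB * YC - YA * YN := by
    rw [div_mul_div_comm, div_mul_div_comm, div_le_div_iff_of_pos_right hZY2] at hR1Y
    nlinarith
  have key : (0 * YB + 0 * YE + 0 * YB + q * (0 * YD) + q * (0 * YE) + XD * YB) *
        (0 * YA + XE * YA + 0 * YC + q * (XD * YC) + q * (XE * YC) + 0 * YD) -
      (0 * YA + 0 * YC + 0 * YD + 0 * YA + q * (0 * YC) + XD * YA) *
        (0 * YB + 0 * YE + XE * YB + q * (0 * YD) + q * (0 * YE) + q * (XD * YN) + q * (XE * YN) - q * (0 * YN)) =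
      q * (XD * (XD + XE)) * (YB * YC - YA * YN) := by
    ring
  have hfin : 0 ≤ q * (XD * (XD + XE)) * (YB * YC - YA * YN) :=
    mul_nonneg (mul_nonneg hq.le (mul_nonneg (hnn _ _) (add_nonneg (hnn _ _) (hnn _ _)))) ρY
  linarith [key, hfin]

end Pendant

end ApexTwoSum

end Summit.CriticalPhenomena.PercolationContinuityZ3.Theorems
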